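import Literature.Probability.RandomPlanarGeometry.SAWCountMonotoneFractional
import HarnessLib

/-!
# Monotonicity `cₙ ≤ cₙ₊₁` (O'Brien 1990): the SELF-ADJUSTING fractional certificate — popularity-
# discounted masses on any repair relation

Sequel of `SAWCountMonotoneFractional.lean` (`count_le_count_succ_of_fractional`: `cₙ ≤ cₙ₊₁` follows from
nonnegative rational masses spreading each doubly trapped walk `ω ∈ T₂ = doublyTrapped d n` over `n`-step
walks with total `1`, no walk `ω'` receiving more than its spare capacity `extCount ω' n - 2`, resp.
`extCount ω' n - 1` when its start is not completely surrounded) and of `SAWCountMonotoneHall.lean` (uniform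
masses: out-degree `≥ D`, in-degree `≤ D · capacity`).  The uniform masses waste the certificate on popular
images: with the multi-mast relation of the lane's programme the worst-loaded walk receives `1/3 … 1/10` of its
capacity for `n ≤ 20` on `ℤ²`, but the ratio grows with `n` (lane note `OBRIEN-DESIGN-2.md` §7).  Here the
masses are chosen by the RECEIVING side: a doubly trapped `ω` related to `ω'` sends it the share
`spareCap ω' / indeg ω'` of its unit, normalised by

  `Z(ω) = Σ_{ω' : R ω ω'} spareCap ω' / indeg ω'`,   `indeg ω' = #{ω ∈ T₂ : R ω ω'}`.

Column sums are then AUTOMATICALLY within capacity, and the only hypothesis left is local to the source: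

* `spareCap` : the spare capacity `extCount ω' n - 1` (open start) / `extCount ω' n - 2` (surrounded start);
* `count_le_count_succ_of_selfAdjusting` : **if every doubly trapped `ω` has `Z(ω) ≥ 1` for some relation
  `R`, then `cₙ ≤ cₙ₊₁`.**

On `ℤ²` with the multi-mast relation (all mast lengths) the measured minimum of `Z` over `T₂(n)` is
`37.2, 33.1, 30.0, 25.6, 24.6` for `n = 14, …, 18` and the maximal load `≤ 0.041` of capacity (lane kit
j305341; `OBRIEN-DESIGN-3.md`); the all-`n` statement «`Z ≥ 1` on `T₂`» is the lane's standing conjecture for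
the door `BDGS2012_count_mono`, not a result in print.

[cite: MadrasSlade1993, §1.1, §7.1 p. 231] [cite: BDGS2012, §1.3 (`cₙ ≤ cₙ₊₁`, O'Brien 1990)]
-/

noncomputable section

open Literature.Probability.LatticeModels Literature.Probability.Percolation SimpleGraph
open scoped BigOperators

namespace Literature.Probability.RandomPlanarGeometry.SAW.Zd

variable {d : ℕ}

open Classical in
/-- The **spare capacity** of an `n`-step walk `ω'` as a receiver of doubly trapped walks: `extCount ω' n - 1`
if its start is not completely surrounded (`extCount (revWalk n ω') n ≥ 1`), else `extCount ω' n - 2`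
(truncated subtraction). [cite: BDGS2012, §1.3] -/
def spareCap (n : ℕ) (ω' : ℕ → Site d) : ℕ :=
  if 1 ≤ extCount (revWalk n ω') n then extCount ω' n - 1 else extCount ω' n - 2

/-- A receiver with positive spare capacity satisfies the column condition of the weighted pairing lemma for
any mass `S ≤ spareCap`. [cite: BDGS2012, §1.3] -/
theorem col_condition_of_le_spareCap {n : ℕ} {ω' : ℕ → Site d} {S : ℚ} (hS0 : 0 ≤ S)
    (hS : S ≤ (spareCap n ω' : ℚ)) :
    S = 0 ∨ S + 2 ≤ extCount ω' n ∨ (S + 1 ≤ extCount ω' n ∧ 1 ≤ extCount (revWalk n ω') n) := by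
  by_cases hc : spareCap n ω' = 0
  · left
    rw [hc, Nat.cast_zero] at hS
    linarith
  · right
    unfold spareCap at hS hc
    split_ifs at hS hc with h
    · right
      refine ⟨?_, h⟩
      have : ((extCount ω' n - 1 : ℕ) : ℚ) + 1 = extCount ω' n := by
        rw [Nat.cast_sub (by omega)]; push_cast; ring
      linarith
    · left
      have : ((extCount ω' n - 2 : ℕ) : ℚ) + 2 = extCount ω' n := by
        rw [Nat.cast_sub (by omega)]; push_cast; ring
      linarith

open Classical in
/-- **O'Brien's inequality from a self-adjusting certificate.** Let `R` relate doubly trapped `n`-step walks to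
`n`-step self-avoiding walks, let `indeg ω' = #{ω ∈ T₂ : R ω ω'}` and
`Z(ω) = Σ_{ω' ∈ 𝒲ₙ, R ω ω'} spareCap ω' / indeg ω'`. If `Z(ω) ≥ 1` for every `ω ∈ T₂`, then `cₙ ≤ cₙ₊₁`: the
masses `W ω ω' = (spareCap ω' / indeg ω') / Z(ω)` have row sums `1` and column sums `≤ spareCap ω'`.
[cite: BDGS2012, §1.3] -/
theorem count_le_count_succ_of_selfAdjusting {n : ℕ} (R : (ℕ → Site d) → (ℕ → Site d) → Prop)
    (hZ : ∀ ω ∈ doublyTrapped d n,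
      (1 : ℚ) ≤ ∑ ω' ∈ (saws d n).filter (fun ω' => R ω ω'),
        (spareCap n ω' : ℚ) / ((doublyTrapped d n).filter (fun ω => R ω ω')).card) :
    count d n ≤ count d (n + 1) := by
  classical
  set indeg : (ℕ → Site d) → ℕ := fun ω' => ((doublyTrapped d n).filter (fun ω => R ω ω')).card with hindeg
  set share : (ℕ → Site d) → ℚ := fun ω' => (spareCap n ω' : ℚ) / indeg ω' with hshare
  set Z : (ℕ → Site d) → ℚ := fun ω => ∑ ω' ∈ (saws d n).filter (fun ω' => R ω ω'), share ω' with hZdef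
  have hshare0 : ∀ ω', 0 ≤ share ω' := fun ω' => by simp only [hshare]; positivity
  have hZ1 : ∀ ω ∈ doublyTrapped d n, 1 ≤ Z ω := fun ω hω => hZ ω hω
  set W : (ℕ → Site d) → (ℕ → Site d) → ℚ :=
    fun ω ω' => if ω ∈ doublyTrapped d n ∧ ω' ∈ saws d n ∧ R ω ω' then share ω' / Z ω else 0 with hW
  have hW0 : ∀ ω ω', 0 ≤ W ω ω' := fun ω ω' => by
    simp only [hW]
    split_ifs with h
    · exact div_nonneg (hshare0 ω') (le_trans zero_le_one (hZ1 ω h.1))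
    · exact le_rfl
  refine count_le_count_succ_of_fractional W hW0 (fun ω hω => ?_) (fun ω' hω' => ?_)
  · -- row sums: `Z ω / Z ω = 1`
    have hZpos : 0 < Z ω := lt_of_lt_of_le zero_lt_one (hZ1 ω hω)
    have : ∑ ω' ∈ saws d n, W ω ω' = ∑ ω' ∈ (saws d n).filter (fun ω' => R ω ω'), share ω' / Z ω := by
      rw [Finset.sum_filter]
      refine Finset.sum_congr rfl fun ω' hω' => ?_
      simp only [hW, hω, hω', true_and]
    rw [this, ← Finset.sum_div, div_self hZpos.ne']
  · -- column sums: at most `indeg ω' · share ω' = spareCap ω'`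
    have h1 : ∑ ω ∈ doublyTrapped d n, W ω ω' =
        ∑ ω ∈ (doublyTrapped d n).filter (fun ω => R ω ω'), share ω' / Z ω := by
      rw [Finset.sum_filter]
      refine Finset.sum_congr rfl fun ω hω => ?_
      simp only [hW, hω, hω', true_and]
    have h2 : ∀ ω ∈ (doublyTrapped d n).filter (fun ω => R ω ω'), share ω' / Z ω ≤ share ω' := by
      intro ω hω
      have hz := hZ1 ω (Finset.mem_filter.1 hω).1
      exact div_le_self (hshare0 ω') hz
    have hS : ∑ ω ∈ doublyTrapped d n, W ω ω' ≤ (spareCap n ω' : ℚ) := by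
      rw [h1]
      refine (Finset.sum_le_sum h2).trans ?_
      rw [Finset.sum_const, nsmul_eq_mul]
      simp only [hshare, hindeg]
      by_cases h0 : ((doublyTrapped d n).filter (fun ω => R ω ω')).card = 0
      · rw [h0]; simp
      · rw [mul_div_cancel₀]
        exact_mod_cast h0
    have hS0 : 0 ≤ ∑ ω ∈ doublyTrapped d n, W ω ω' := Finset.sum_nonneg fun ω _ => hW0 ω ω'
    exact col_condition_of_le_spareCap hS0 hS

end Literature.Probability.RandomPlanarGeometry.SAW.Zd
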